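import Summits.SmoothPoincare4.SmoothPoincare4.Theorems.SymplecticOrigamiGromovRecognitionRelEndHolCoordCompJHol
import Mathlib.Analysis.Analytic.IsolatedZeros
import Mathlib.Analysis.Complex.CauchyIntegral
import Mathlib.Analysis.Normed.Field.Lemmas
import Mathlib.Analysis.Normed.Group.Bounded
import Mathlib.Topology.DiscreteSubset

/-!
# A `JX`-sphere not inside the sphere at infinity meets it in finitely many parameter points
(registered helper `helper_sphereWedgeZerosFinite` of line `cross-cap-laurent`, crux
`GromovRecognitionRelEnd`, item stmt-SmoothPoincare4-11009)

Setting: `X` is a `C^∞` real `4`-manifold with a family of tangent-space endomorphisms `JX`,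
`U ⊆ X` is open and `T : X → ℂ` is `C^∞` and `JX`-holomorphic on `U` (`dT (JX w) = i · dT w`),
with `{y ∈ U | T y = 0}` closed in `X` (the "sphere at infinity" `H∞` of a wedge cap).  A
`JX`-holomorphic sphere is given in two-chart form: `C^∞` maps `u v : ℂ → X`, both
`J`-holomorphic (`Literature.Geometry.Symplectic.IsJHolomorphic`), with `v w = u w⁻¹` for `w ≠ 0`.
If the sphere is not contained in `H∞` (some `u z ∉ H∞`), then the set
`Z = {z | u z ∈ U ∧ T (u z) = 0}` of parameter values at which `u` meets `H∞` is finite.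

Proof.  `f := T ∘ u` is complex differentiable, hence analytic, on the open set `O := u ⁻¹' U`
(`helper_holCoordCompJHol`, `DifferentiableOn.analyticOnNhd`), and `Z = {z ∈ O | f z = 0}` is
closed in `ℂ`.
(i) `interior Z = ∅`: `interior Z` is open, and closed by the local dichotomy for analytic functions
(`AnalyticAt.eventually_eq_zero_or_eventually_ne_zero`) at points of `closure (interior Z) ⊆ Z ⊆ O`;
`ℂ` is connected and `Z ≠ univ`.  Consequently every point of `O` has a punctured neighbourhood
free of zeros of `f`, so `Z` is discrete.
(ii) `Z` is bounded: otherwise `z⁻¹ ∈ Z` frequently near `0`, so (`v w = u w⁻¹`, closedness)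
`v 0 ∈ U` and the analytic germ of `g := T ∘ v` at `0` vanishes identically
(`AnalyticAt.frequently_zero_iff_eventually_zero`); transporting back, `Z` contains
`{z | R < ‖z‖}` for some `R`, a non-empty open set — contradicting (i).
(iii) closed + bounded = compact (`ℂ` is proper), and a compact discrete set is finite
(`IsCompact.finite`).

References: principle of isolated zeros (Mathlib `Mathlib.Analysis.Analytic.IsolatedZeros`);
C. Hummel, *Gromov's Compactness Theorem for Pseudo-holomorphic Curves* (1997), Ch. I §3
(`J`-holomorphic maps in holomorphic coordinates).  No new definitions, notation or instances.
-/

noncomputable section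

-- the prescribed namespace `Summit.<P>.<Sub>.…` duplicates `SmoothPoincare4` (P = Sub)
set_option linter.dupNamespace false

open scoped Manifold ContDiff Topology
open Set Filter Bornology
open Literature.Geometry.Symplectic

namespace Summit.SmoothPoincare4.SmoothPoincare4.Theorems.GromovRecognitionRelEnd.CrossCapLaurent

/-- **No open set of zeros.** If `f : ℂ → ℂ` is analytic on a neighbourhood of every point of the
open set `O`, the zero set `{z ∈ O | f z = 0}` is closed in `ℂ` and is not all of `ℂ`, then it has
empty interior: its interior is clopen (closedness by the local dichotomy
`AnalyticAt.eventually_eq_zero_or_eventually_ne_zero` at limit points, which lie in the closed zero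
set, hence in `O`), and `ℂ` is connected. -/
theorem interior_zeroSet_eq_empty {f : ℂ → ℂ} {O : Set ℂ} (hO : IsOpen O)
    (hf : AnalyticOnNhd ℂ f O) (hZ : IsClosed {z : ℂ | z ∈ O ∧ f z = 0})
    (hne : ∃ z : ℂ, ¬ (z ∈ O ∧ f z = 0)) :
    interior {z : ℂ | z ∈ O ∧ f z = 0} = ∅ := by
  -- the interior of the zero set is closed
  have hclo : IsClosed (interior {z : ℂ | z ∈ O ∧ f z = 0}) := by
    refine isClosed_of_closure_subset fun z hz => ?_
    have hzZ : z ∈ {z : ℂ | z ∈ O ∧ f z = 0} :=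
      hZ.closure_subset (closure_mono interior_subset hz)
    rcases (hf z hzZ.1).eventually_eq_zero_or_eventually_ne_zero with h | h
    · rw [mem_interior_iff_mem_nhds]
      filter_upwards [h, hO.mem_nhds hzZ.1] with w hw hwO using ⟨hwO, hw⟩
    · rw [mem_closure_iff_nhds] at hz
      obtain ⟨e, he, heZ⟩ := hz _ (eventually_nhdsWithin_iff.mp h)
      by_cases hez : e = z
      · exact hez ▸ heZ
      · exact absurd (interior_subset heZ).2 (he hez)
  rcases isClopen_iff.mp ⟨hclo, isOpen_interior⟩ with h | h
  · exact h
  · exfalso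
    obtain ⟨z, hz⟩ := hne
    apply hz
    apply interior_subset (s := {z : ℂ | z ∈ O ∧ f z = 0})
    rw [h]
    exact mem_univ z

/-- **Zeros are isolated.** Under the hypotheses of `interior_zeroSet_eq_empty` packaged as
`interior {z ∈ O | f z = 0} = ∅`, at every point `z₀ ∈ O` the analytic function `f` is non-zero
on a punctured neighbourhood of `z₀` (the alternative `f = 0` near `z₀` of
`AnalyticAt.eventually_eq_zero_or_eventually_ne_zero` would put `z₀` in the interior of the zero
set). -/
theorem eventually_ne_zero_of_interior_zeroSet_eq_empty {f : ℂ → ℂ} {O : Set ℂ} (hO : IsOpen O)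
    (hf : AnalyticOnNhd ℂ f O) (hint : interior {z : ℂ | z ∈ O ∧ f z = 0} = ∅) {z₀ : ℂ}
    (hz₀ : z₀ ∈ O) : ∀ᶠ w in 𝓝[≠] z₀, f w ≠ 0 := by
  rcases (hf z₀ hz₀).eventually_eq_zero_or_eventually_ne_zero with h | h
  · have hmem : z₀ ∈ interior {z : ℂ | z ∈ O ∧ f z = 0} := by
      rw [mem_interior_iff_mem_nhds]
      filter_upwards [h, hO.mem_nhds hz₀] with w hw hwO using ⟨hwO, hw⟩
    rw [hint] at hmem
    exact absurd hmem (notMem_empty _)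
  · exact h

/-- **A sphere not inside the sphere at infinity meets it in finitely many parameter points.**
For `U ⊆ X` open, `T : X → ℂ` smooth and `JX`-holomorphic on `U` with `{y ∈ U | T y = 0}` closed,
and a `JX`-holomorphic sphere in two-chart form `u, v : ℂ → X` (`C^∞`, `J`-holomorphic,
`v w = u w⁻¹` for `w ≠ 0`) with some `u z` outside `{y ∈ U | T y = 0}`, the set
`{z | u z ∈ U ∧ T (u z) = 0}` is finite: it is closed, discrete (isolated zeros of the holomorphic
function `T ∘ u`, `helper_holCoordCompJHol`), and bounded (isolated zeros of `T ∘ v` at `w = 0`),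
hence compact and discrete, hence finite. -/
theorem helper_sphereWedgeZerosFinite : ∀ (X : Type) [TopologicalSpace X] [ChartedSpace (EuclideanSpace ℝ (Fin 4)) X] [IsManifold (𝓡 4) ∞ X] (JX : ∀ y : X, TangentSpace (𝓡 4) y →L[ℝ] TangentSpace (𝓡 4) y) (T : X → ℂ) (U : Set X) (u v : ℂ → X), IsOpen U → ContMDiffOn (𝓡 4) 𝓘(ℝ, ℂ) ∞ T U → (∀ y ∈ U, ∀ w : TangentSpace (𝓡 4) y, (show ℂ from mfderiv (𝓡 4) 𝓘(ℝ, ℂ) T y (JX y w)) = Complex.I * (show ℂ from mfderiv (𝓡 4) 𝓘(ℝ, ℂ) T y w)) → IsClosed {y : X | y ∈ U ∧ T y = 0} → ContMDiff 𝓘(ℝ, ℂ) (𝓡 4) ∞ u → ContMDiff 𝓘(ℝ, ℂ) (𝓡 4) ∞ v → (∀ z : ℂ, z ≠ 0 → v z = u z⁻¹) → Literature.Geometry.Symplectic.IsJHolomorphic (𝓡 4) JX u → Literature.Geometry.Symplectic.IsJHolomorphic (𝓡 4) JX v → (∃ z : ℂ, ¬ (u z ∈ U ∧ T (u z) = 0))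 → {z : ℂ | u z ∈ U ∧ T (u z) = 0}.Finite := by
  intro X _ _ _ JX T U u v hU hT hTJ hcl hu hv huv hJu hJv hex
  have huc : Continuous u := hu.continuous
  have hvc : Continuous v := hv.continuous
  have hO : IsOpen (u ⁻¹' U) := hU.preimage huc
  have hV : IsOpen (v ⁻¹' U) := hU.preimage hvc
  -- `T ∘ u` and `T ∘ v` are holomorphic on the preimages of `U`
  have hf : AnalyticOnNhd ℂ (T ∘ u) (u ⁻¹' U) :=
    (helper_holCoordCompJHol X JX T U u hU hT hTJ hu hJu).analyticOnNhd hO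
  have hg : AnalyticOnNhd ℂ (T ∘ v) (v ⁻¹' U) :=
    (helper_holCoordCompJHol X JX T U v hU hT hTJ hv hJv).analyticOnNhd hV
  -- the zero set `Z` is closed, has empty interior, and is discrete
  have hZcl : IsClosed {z : ℂ | u z ∈ U ∧ T (u z) = 0} := hcl.preimage huc
  have hint : interior {z : ℂ | u z ∈ U ∧ T (u z) = 0} = ∅ :=
    interior_zeroSet_eq_empty (f := T ∘ u) (O := u ⁻¹' U) hO hf hZcl hex
  have hisol : ∀ z₀ : ℂ, u z₀ ∈ U → ∀ᶠ w in 𝓝[≠] z₀, (T ∘ u) w ≠ 0 := fun z₀ hz₀ =>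
    eventually_ne_zero_of_interior_zeroSet_eq_empty (f := T ∘ u) (O := u ⁻¹' U) hO hf hint hz₀
  -- (ii) `Z` is bounded
  have hbdd : IsBounded {z : ℂ | u z ∈ U ∧ T (u z) = 0} := by
    by_contra hnb
    -- `Z` is met frequently near infinity, i.e. `w⁻¹ ∈ Z` frequently on a punctured
    -- neighbourhood of `0`
    have h1 : ∃ᶠ z in cobounded ℂ, z ∈ {z : ℂ | u z ∈ U ∧ T (u z) = 0} := by
      rw [Filter.Frequently, Filter.Eventually]
      rwa [isBounded_def, Set.compl_def] at hnb
    have h2 : ∃ᶠ w in 𝓝[≠] (0 : ℂ), w⁻¹ ∈ {z : ℂ | u z ∈ U ∧ T (u z) = 0} :=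
      Filter.tendsto_inv₀_cobounded'.frequently (by simpa only [inv_inv] using h1)
    -- in terms of the second chart `v`
    have h3 : ∃ᶠ w in 𝓝[≠] (0 : ℂ), v w ∈ U ∧ T (v w) = 0 := by
      refine (h2.and_eventually self_mem_nhdsWithin).mono ?_
      rintro w ⟨hwZ, hw0⟩
      rw [huv w hw0]
      exact hwZ
    -- hence `v 0` lies on the (closed) zero locus, so `T ∘ v` is analytic at `0` and vanishes
    -- identically near `0`
    have h0 : v 0 ∈ U ∧ T (v 0) = 0 :=
      (h3.filter_mono nhdsWithin_le_nhds).mem_of_closed (hcl.preimage hvc)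
    have h4 : ∀ᶠ w in 𝓝 (0 : ℂ), (T ∘ v) w = 0 :=
      (hg 0 h0.1).frequently_zero_iff_eventually_zero.mp (h3.mono fun w hw => hw.2)
    -- transporting back: `z ∈ Z` for all `z` near infinity
    have h5 : ∀ᶠ w in 𝓝[≠] (0 : ℂ), w⁻¹ ∈ {z : ℂ | u z ∈ U ∧ T (u z) = 0} := by
      have h4' : ∀ᶠ w in 𝓝[≠] (0 : ℂ), (T ∘ v) w = 0 ∧ v w ∈ U :=
        nhdsWithin_le_nhds (h4.and (hV.mem_nhds h0.1))
      filter_upwards [h4', self_mem_nhdsWithin] with w hw hw0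
      show u w⁻¹ ∈ U ∧ T (u w⁻¹) = 0
      rw [← huv w hw0]
      exact ⟨hw.2, hw.1⟩
    have h6 : ∀ᶠ z in cobounded ℂ, z ∈ {z : ℂ | u z ∈ U ∧ T (u z) = 0} := by
      simpa only [inv_inv] using Filter.tendsto_inv₀_cobounded'.eventually h5
    obtain ⟨R, -, hR⟩ := Filter.hasBasis_cobounded_norm.mem_iff.mp h6
    simp only [Set.subset_def, mem_setOf_eq] at hR
    -- the non-empty open set `{z | R < ‖z‖}` lies in `Z`, contradicting `interior Z = ∅`
    have hsub : {z : ℂ | R < ‖z‖} ⊆ interior {z : ℂ | u z ∈ U ∧ T (u z) = 0} :=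
      interior_maximal (fun z hz => hR z (le_of_lt hz)) (isOpen_lt continuous_const continuous_norm)
    have hmem : ((|R| + 1 : ℝ) : ℂ) ∈ interior {z : ℂ | u z ∈ U ∧ T (u z) = 0} := by
      refine hsub ?_
      show R < ‖((|R| + 1 : ℝ) : ℂ)‖
      rw [Complex.norm_real, Real.norm_eq_abs, abs_of_pos (by positivity)]
      exact (le_abs_self R).trans_lt (lt_add_one _)
    rw [hint] at hmem
    exact hmem
  -- (iii) closed and bounded, hence compact; discrete, hence finite
  have hK : IsCompact {z : ℂ | u z ∈ U ∧ T (u z) = 0} :=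
    Metric.isCompact_of_isClosed_isBounded hZcl hbdd
  refine hK.finite (isDiscrete_iff_nhdsNE.mpr fun z hz => Filter.inf_principal_eq_bot.mpr ?_)
  filter_upwards [hisol z hz.1] with w hw hwZ
  exact hw hwZ.2

end Summit.SmoothPoincare4.SmoothPoincare4.Theorems.GromovRecognitionRelEnd.CrossCapLaurent
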